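import Summits.BirchSwinnertonDyer.BirchSwinnertonDyer.Theorems.KimAtThreeFineKatoKPortSatLog
import Summits.BirchSwinnertonDyer.Rank1Residual.Additive.AdditiveFormalLogBallIsometry
import Summits.BirchSwinnertonDyer.Rank1Residual.Additive.KobayashiLogFssValues
import HarnessLib

/-!
# K-PORT glue (G3): the logarithm of the minimal model at an ADDITIVE prime over an UNRAMIFIED complete
# field `K ⊇ ℚ_p` — `Λ(E₁(K)) = p𝒪_K`, `‖Λ̃‖ ≤ 1` wherever `p•P ∈ E₁(K)`, and `Λ̃ P = 0 ↔ P` torsion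
# (cell `bsd-addord`, seat w2-kport gen 0; `--supports stmt-BirchSwinnertonDyer-19560`, helper)

HONEST FRAMING. Route W2 (`route-BirchSwinnertonDyer-KimAtThreeKolyvagin`), crux 19560
`KatoKuriharaPortThreeShared`, residual ⟨C1⟩ clause (C1.c) = SAT₀'s E-side over the completions
`K = K_w` of the tame Kolyvagin fields at `w ∣ 3`, UNRAMIFIED over `ℚ₃` (kim3 brief KIM3-KPORT-BRIEF-g12
§2: "‖(p : K)‖ = p⁻¹ (UNRAMIFIED normalisation — this is where `log(E₁(K)) ⊆ p𝒪_K` comes from: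
`‖z‖ < 1 ⇒ ‖z‖ ≤ p⁻¹` needs value group `p^ℤ`)", §3 (P2): "`‖log P‖ ≤ 1` on `E₀(K)` and `≤ 3⁻¹` on
`E₁(K)`"). Inputs, all in the tree: n1011's COROLLARY (a) of LEMMA A for EVERY complete ultrametric
`K ⊇ ℚ_p` (`Additive/AdditiveFormalLogBallIsometry` §3: at an additive prime of a globally minimal
`W/ℚ`, `Λ = BallEval.ptLog` satisfies `‖Λ(P)‖ = ‖z(P)‖` on `E₁(K)`, is injective there and maps onto
`𝔪_K`), and the saturated logarithm `Λ̃ = satLog` (`…KPortSatLog`). "Unramified" enters only as the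
hypothesis `hK : ∀ x : K, ‖x‖ < 1 → ‖x‖ ≤ ‖(p : K)‖` (the value group of `K` is generated by `‖p‖`),
which the completions of an unramified extension satisfy; nothing else about `K` is used.
TOOL theorems only (no definition, no named fact, no `sorry`); closes nothing by itself; nothing booked.

## What is proved (`M = W_ℤ ⊗ ℤ_p`, `E = BallEval.curveK p K M = W ⊗ K`, `E₁(K) = FormalGroupChart.kernel`)

* §1 (any complete `K ⊇ ℚ_p`, `Addv W p`): `mem_satKernel_of_isOfFinAddOrder` (torsion ⊆ `Ẽ₁(K)`, any `M`),
  **`satLog_eq_zero_iff_isOfFinAddOrder_of_addv`** (`Λ̃ P = 0 ↔ P` torsion, on `Ẽ₁(K)`; the kernel of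
  `log_ω` is the torsion, as for n1011's `padicLog_eq_zero_iff` over `ℚ_p`).
* §2 (`hK` unramified; `‖p‖ = p⁻¹` is the tree's `HondaFss.norm_natCast_p`): **`norm_ptLog_le_norm_prime_of_addv`**
  (`Λ(E₁(K)) ⊆ p𝒪_K`), **`exists_mem_kernel_satLog_eq_of_addv`** (`Λ : E₁(K) → p𝒪_K` is ONTO, with
  `‖z(P)‖ = ‖y‖`), **`norm_satLog_le_one_of_prime_nsmul_mem_of_addv`** (`p•P ∈ E₁(K) ⇒ ‖Λ̃ P‖ ≤ 1` — the
  bound `‖log Q‖ ≤ 1` on `E₀(K)` of SAT₀ once `p•E₀(K) ⊆ E₁(K)`), `norm_satLog_le_inv_of_mem_kernel_of_addv`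
  (`‖Λ̃‖ ≤ p⁻¹` on `E₁(K)`).

References: J. H. Silverman, *The Arithmetic of Elliptic Curves*, 2nd ed. (2009), IV.6.4, Prop. VII.2.2
[SilvermanAEC2009]; kim3 brief HOME/kim3/KIM3-KPORT-BRIEF-g12.md §2–§3; n1011 p05 GEN 13 (LEMMA A (a)).
-/

noncomputable section

-- the cell's Theorems namespace `Summit.BirchSwinnertonDyer.BirchSwinnertonDyer.…` repeats the summit name by design (D-0017)
set_option linter.dupNamespace false

open scoped Classical

namespace Summit.BirchSwinnertonDyer.BirchSwinnertonDyer.Theorems.KPort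

open Summit.BirchSwinnertonDyer.Rank1Residual.Additive
open Summit.BirchSwinnertonDyer.Rank1Residual.Additive.BallEval
open Literature.NumberTheory.GaloisRepresentations.LubinTate (unitBall mem_unitBall_iff)
open Literature.NumberTheory.EllipticCurves Literature.NumberTheory.EllipticCurves.FormalGroupChart
open Literature.NumberTheory.EllipticCurves.Rank1Residual WeierstrassCurve

variable {p : ℕ} [hp : Fact p.Prime] {K : Type*} [NontriviallyNormedField K] [NormedAlgebra ℚ_[p] K]
  [IsUltrametricDist K] [CompleteSpace K]

/-! ## §1 Torsion and the kernel of `Λ̃` -/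

section Torsion

variable {M : WeierstrassCurve ℤ_[p]} [(curveK p K M).IsIntegral (NormedField.valuation (K := K)).integer]

omit [CompleteSpace K] in
/-- Torsion points lie in `Ẽ₁(K)` (`n • P = O ∈ E₁(K)`). [folklore] -/
theorem mem_satKernel_of_isOfFinAddOrder {P : (curveK p K M).toAffine.Point} (hP : IsOfFinAddOrder P) :
    P ∈ satKernel p K M := by
  obtain ⟨n, hn, hnP⟩ := (isOfFinAddOrder_iff_nsmul_eq_zero).mp hP
  refine mem_satKernel_of_nsmul_mem hn ?_
  rw [hnP]
  exact (kernel (NormedField.valuation (K := K)) (curveK p K M)).zero_mem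

end Torsion

section Additive

variable (W : WeierstrassCurve ℚ) [W.IsElliptic] [W.IsGloballyMinimal]
  [hint : (curveK p K ((integralModelInt W).map (Int.castRingHom ℤ_[p]))).IsIntegral
    (NormedField.valuation (K := K)).integer]

/-- **At an additive prime, `Λ̃ P = 0 ↔ P` is torsion** for `P ∈ Ẽ₁(K)` (`Λ̃ P = Λ(n•P)/n`, and `Λ` is
injective on `E₁(K)` by n1011's `ptLog_eq_zero_iff_of_addv`); so `ker Λ̃ = Ẽ₁(K)_tors` — over `K`, the
analogue of n1011's `padicLog_eq_zero_iff`. [cite: SilvermanAEC2009, IV.6.4 and Prop. VII.2.2] -/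
theorem satLog_eq_zero_iff_isOfFinAddOrder_of_addv (hadd : Addv W p)
    {P : (curveK p K ((integralModelInt W).map (Int.castRingHom ℤ_[p]))).toAffine.Point}
    (hP : P ∈ satKernel p K ((integralModelInt W).map (Int.castRingHom ℤ_[p]))) :
    satLog p K ((integralModelInt W).map (Int.castRingHom ℤ_[p])) P = 0 ↔ IsOfFinAddOrder P := by
  haveI := isElliptic_map_coe_integralModelInt W p
  haveI : CharZero K := charZero_of_injective_algebraMap (algebraMap ℚ_[p] K).injective
  obtain ⟨n, hn, hnP⟩ := mem_satKernel_iff.mp hP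
  rw [satLog_eq_div hn hnP, div_eq_zero_iff, or_iff_left (Nat.cast_ne_zero.mpr hn.ne'),
    ptLog_eq_zero_iff_of_addv W p K hadd hnP, isOfFinAddOrder_iff_nsmul_eq_zero]
  constructor
  · exact fun h => ⟨n, hn, h⟩
  · rintro ⟨m, hm, hmP⟩
    -- `n • P ∈ E₁(K)` is torsion (`m • (n • P) = 0`), and `E₁(K)` has no torsion at an additive prime
    have hmn : m • (n • P) = 0 := by rw [← mul_nsmul, mul_comm, mul_nsmul, hmP, nsmul_zero]
    have hmnP : m • (n • P) ∈
        kernel (NormedField.valuation (K := K)) (curveK p K ((integralModelInt W).map (Int.castRingHom ℤ_[p]))) :=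
      (kernel (NormedField.valuation (K := K)) _).nsmul_mem hnP m
    have h0 : ptLog p K ((integralModelInt W).map (Int.castRingHom ℤ_[p])) (m • (n • P)) = 0 := by
      rw [hmn, ptLog_zero]
    rw [ptLog_nsmul hnP m, mul_eq_zero, or_iff_right (Nat.cast_ne_zero.mpr hm.ne')] at h0
    exact (ptLog_eq_zero_iff_of_addv W p K hadd hnP).mp h0

end Additive

/-! ## §2 Unramified `K`: `Λ(E₁(K)) = p𝒪_K` and `‖Λ̃‖ ≤ 1` on `p⁻¹E₁(K)` -/

section Unramified

variable (W : WeierstrassCurve ℚ) [W.IsElliptic] [W.IsGloballyMinimal]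
  [hint : (curveK p K ((integralModelInt W).map (Int.castRingHom ℤ_[p]))).IsIntegral
    (NormedField.valuation (K := K)).integer]

/-- **`Λ(E₁(K)) ⊆ p𝒪_K` at an additive prime over an unramified `K`**: `‖Λ(P)‖ = ‖z(P)‖ < 1`, hence
`≤ ‖p‖ = p⁻¹` (the brief's "`log(E₁(K)) ⊆ 3𝒪_K`"). [cite: SilvermanAEC2009, IV.6.4 and Prop. VII.2.2] -/
theorem norm_ptLog_le_norm_prime_of_addv (hadd : Addv W p) (hK : ∀ x : K, ‖x‖ < 1 → ‖x‖ ≤ ‖(p : K)‖)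
    {P : (curveK p K ((integralModelInt W).map (Int.castRingHom ℤ_[p]))).toAffine.Point}
    (hP : P ∈ kernel (NormedField.valuation (K := K))
      (curveK p K ((integralModelInt W).map (Int.castRingHom ℤ_[p])))) :
    ‖ptLog p K ((integralModelInt W).map (Int.castRingHom ℤ_[p])) P‖ ≤ ‖(p : K)‖ := by
  rw [norm_ptLog_eq_of_addv W p K hadd hP]
  exact hK _ (norm_zCoord_lt_one hP)

/-- The same with `p⁻¹` displayed: `‖Λ(P)‖ ≤ p⁻¹` on `E₁(K)`. [cite: SilvermanAEC2009, IV.6.4 and Prop. VII.2.2] -/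
theorem norm_ptLog_le_inv_of_addv (hadd : Addv W p) (hK : ∀ x : K, ‖x‖ < 1 → ‖x‖ ≤ ‖(p : K)‖)
    {P : (curveK p K ((integralModelInt W).map (Int.castRingHom ℤ_[p]))).toAffine.Point}
    (hP : P ∈ kernel (NormedField.valuation (K := K))
      (curveK p K ((integralModelInt W).map (Int.castRingHom ℤ_[p])))) :
    ‖ptLog p K ((integralModelInt W).map (Int.castRingHom ℤ_[p])) P‖ ≤ (p : ℝ)⁻¹ := by
  rw [← HondaFss.norm_natCast_p (p := p) (K := K)]
  exact norm_ptLog_le_norm_prime_of_addv W hadd hK hP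

/-- `‖Λ̃(P)‖ ≤ p⁻¹` on `E₁(K)` (`Λ̃ = Λ` there). [cite: SilvermanAEC2009, IV.6.4 and Prop. VII.2.2] -/
theorem norm_satLog_le_inv_of_mem_kernel_of_addv (hadd : Addv W p)
    (hK : ∀ x : K, ‖x‖ < 1 → ‖x‖ ≤ ‖(p : K)‖)
    {P : (curveK p K ((integralModelInt W).map (Int.castRingHom ℤ_[p]))).toAffine.Point}
    (hP : P ∈ kernel (NormedField.valuation (K := K))
      (curveK p K ((integralModelInt W).map (Int.castRingHom ℤ_[p])))) :
    ‖satLog p K ((integralModelInt W).map (Int.castRingHom ℤ_[p])) P‖ ≤ (p : ℝ)⁻¹ := by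
  haveI := isElliptic_map_coe_integralModelInt W p
  rw [satLog_of_mem hP]
  exact norm_ptLog_le_inv_of_addv W hadd hK hP

/-- **The SAT₀ bound: `‖Λ̃(P)‖ ≤ 1` whenever `p • P ∈ E₁(K)`** (additive prime, unramified `K`): `p Λ̃(P) =
Λ(p•P) ∈ p𝒪_K`. With `p • E₀(K) ⊆ E₁(K)` (additive reduction: `E₀/E₁ ≅ k⁺` is `p`-torsion) this is
`‖log Q‖ ≤ 1` on `E₀(K)`. [cite: SilvermanAEC2009, IV.6.4 and Prop. VII.2.2] -/
theorem norm_satLog_le_one_of_prime_nsmul_mem_of_addv (hadd : Addv W p)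
    (hK : ∀ x : K, ‖x‖ < 1 → ‖x‖ ≤ ‖(p : K)‖)
    {P : (curveK p K ((integralModelInt W).map (Int.castRingHom ℤ_[p]))).toAffine.Point}
    (hP : p • P ∈ kernel (NormedField.valuation (K := K))
      (curveK p K ((integralModelInt W).map (Int.castRingHom ℤ_[p])))) :
    ‖satLog p K ((integralModelInt W).map (Int.castRingHom ℤ_[p])) P‖ ≤ 1 :=
  haveI := isElliptic_map_coe_integralModelInt W p
  norm_satLog_le_one_of_prime_nsmul hP (norm_ptLog_le_norm_prime_of_addv W hadd hK hP)

/-- **`Λ : E₁(K) → p𝒪_K` is ONTO** (additive prime, unramified `K`): every `y` with `‖y‖ ≤ ‖p‖` is `Λ̃(P) =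
Λ(P)` for some `P ∈ E₁(K)` with `‖z(P)‖ = ‖y‖` (n1011's `exists_ptLog_eq_of_addv`, `‖p‖ < 1`). Together
with `norm_ptLog_le_norm_prime_of_addv`: `Λ(E₁(K)) = p𝒪_K` exactly — the K-analogue of kim3 g12's
`log(E₁(ℚ₃)) = 3ℤ₃`. [cite: SilvermanAEC2009, IV.6.4 and Prop. VII.2.2] -/
theorem exists_mem_kernel_satLog_eq_of_addv (hadd : Addv W p) {y : K} (hy : ‖y‖ ≤ ‖(p : K)‖) :
    ∃ P ∈ kernel (NormedField.valuation (K := K))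
        (curveK p K ((integralModelInt W).map (Int.castRingHom ℤ_[p]))),
      satLog p K ((integralModelInt W).map (Int.castRingHom ℤ_[p])) P = y ∧ ‖P.zCoord‖ = ‖y‖ := by
  haveI := isElliptic_map_coe_integralModelInt W p
  have hy1 : ‖y‖ < 1 := hy.trans_lt (norm_p_pos_lt (p := p) (K := K)).2
  obtain ⟨P, hP, hPy, hPz⟩ := exists_ptLog_eq_of_addv W p K hadd hy1
  exact ⟨P, hP, by rw [satLog_of_mem hP, hPy], hPz⟩

/-- The image statement: **`Λ̃(E₁(K)) = {y : ‖y‖ ≤ p⁻¹} = p𝒪_K`** (additive prime, unramified `K`).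
[cite: SilvermanAEC2009, IV.6.4 and Prop. VII.2.2] -/
theorem image_satLog_kernel_of_addv (hadd : Addv W p) (hK : ∀ x : K, ‖x‖ < 1 → ‖x‖ ≤ ‖(p : K)‖) :
    satLog p K ((integralModelInt W).map (Int.castRingHom ℤ_[p])) ''
        (kernel (NormedField.valuation (K := K))
          (curveK p K ((integralModelInt W).map (Int.castRingHom ℤ_[p]))) : Set _) =
      {y : K | ‖y‖ ≤ (p : ℝ)⁻¹} := by
  ext y
  constructor
  · rintro ⟨P, hP, rfl⟩
    exact norm_satLog_le_inv_of_mem_kernel_of_addv W hadd hK hP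
  · intro hy
    rw [Set.mem_setOf_eq, ← HondaFss.norm_natCast_p (p := p) (K := K)] at hy
    obtain ⟨P, hP, hPy, -⟩ := exists_mem_kernel_satLog_eq_of_addv W hadd hy
    exact ⟨P, hP, hPy⟩

end Unramified

end Summit.BirchSwinnertonDyer.BirchSwinnertonDyer.Theorems.KPort

end
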